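import Mathlib
import Summits.Ventures.PercRepro.TriangleCapPairWitness

/-!
# PercRepro — THE MIDDLE REGIME IS AN INTERVAL WHEN `3 t ≤ 2 ℓ + 2` (p3, gen 51; part 251)

On `ℓ + 1 + (s − t)` vertices with `t + 1 ≤ ℓ ≤ 2 t` the band `t` of the pair-count spectrum has the extremal value
`C(t, 2) + ℓ − t` (part 246).  Here EVERY value below it is attained, provided `3 t ≤ 2 ℓ + 2`: the pair witness with
`λ = min (ℓ − t + 1) t` left vertices (`t / 2 ≤ λ ≤ t`) carrying the round-robin left ends `lfRR λ u`, `e` pairs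
ending at distinct non-leaves (`c = ℓ − λ ≥ t − 1` of them) and the rest at distinct leaves, has `attach = t − e`,
no right collisions, and `2 j = 2 e + (t (t − 1) − coll t (lfRR λ u))`; the left staircase moves in steps `≤ 2 t` and
the fill `2 e`, `e ≤ c`, covers every step when `c + 1 ≥ t` (`cover_stair_gen`).  At `u = 0` and `e = c` the top
`C(t, 2) + ℓ − t` is reached (`λ ≥ t / 2`, so the balanced count is `2 (t − λ)`).  Axioms: standard.
-/

namespace PercRepro

namespace TriangleCap

namespace C047

open Finset

/-- **THE COVERING LEMMA WITH A GENERAL FILL:** `E t = 0`, `E` even, `E u ≤ E (u + 1) + 2 t`, fill `2 e` with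
`e ≤ c`, `t ≤ c + 1`: every `2 j ≤ E u' + 2 c` (`u ≤ u' ≤ t`) is `2 e + E u''` for some `u ≤ u'' ≤ t`, `e ≤ c`. -/
theorem cover_stair_gen (t c : ℕ) (hc : t ≤ c + 1) (E : ℕ → ℕ) (hE0 : E t = 0) (hEeven : ∀ u, Even (E u))
    (hstep : ∀ u, u < t → E u ≤ E (u + 1) + 2 * t) :
    ∀ k, k ≤ t → ∀ j, (∃ u', t - k ≤ u' ∧ u' ≤ t ∧ 2 * j ≤ E u' + 2 * c) →
      ∃ u', t - k ≤ u' ∧ u' ≤ t ∧ ∃ e, e ≤ c ∧ 2 * j = 2 * e + E u' := by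
  intro k
  induction k with
  | zero =>
    intro _ j ⟨u', hu1, hu2, hj⟩
    have : u' = t := by omega
    rw [this, hE0] at hj
    exact ⟨t, by omega, le_rfl, j, by omega, by rw [hE0]; omega⟩
  | succ k ih =>
    intro hk j ⟨u', hu1, hu2, hj⟩
    by_cases hu : t - k ≤ u'
    · obtain ⟨u'', h1, h2, e, he, hje⟩ := ih (by omega) j ⟨u', hu, hu2, hj⟩
      exact ⟨u'', by omega, h2, e, he, hje⟩
    · have hu' : u' = t - (k + 1) := by omega
      subst hu'
      by_cases hj' : 2 * j ≤ E (t - (k + 1) + 1) + 2 * c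
      · obtain ⟨u'', h1, h2, e, he, hje⟩ := ih (by omega) j ⟨t - (k + 1) + 1, by omega, by omega, hj'⟩
        exact ⟨u'', by omega, h2, e, he, hje⟩
      · have hs := hstep (t - (k + 1)) (by omega)
        obtain ⟨x, hx⟩ := hEeven (t - (k + 1))
        obtain ⟨y, hy⟩ := hEeven (t - (k + 1) + 1)
        refine ⟨t - (k + 1), le_rfl, by omega, j - x, by omega, ?_⟩
        omega

/-- The right ends of the interval witness: `e` distinct non-leaves `b + i` (`i < e`), then distinct leaves
`a + (i − e)`. -/
def rfSplit (a b e i : ℕ) : ℕ := if i < e then b + i else a + (i - e)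

/-- The balanced collision count for `λ ≤ t < 2 λ` is `2 (t − λ)`. -/
theorem coll_lfRR_zero_half (l t : ℕ) (hl : 1 ≤ l) (h1 : l ≤ t) (h2 : t < 2 * l) :
    coll t (lfRR l 0) = 2 * (t - l) := by
  rw [coll_lfRR_zero l t (by omega)]
  have hq : t / l = 1 := Nat.div_eq_of_lt_le (by omega) (by omega)
  have hr : t % l = t - l := by
    have := Nat.div_add_mod t l
    rw [hq] at this
    omega
  rw [hq, hr]
  ring

/-- The balanced collision count for `t < λ` is `0`. -/
theorem coll_lfRR_zero_small (l t : ℕ) (hl : 1 ≤ l) (h : t < l) : coll t (lfRR l 0) = 0 := by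
  rw [coll_lfRR_zero l t (by omega), Nat.div_eq_of_lt h]
  simp

/-- **THE MIDDLE REGIME IS AN INTERVAL** (`1 ≤ t`, `t + 1 ≤ ℓ ≤ 2 t`, `3 t ≤ 2 ℓ + 2`, `2 t ≤ s`): every `j` with
`2 j + 2 t ≤ t (t − 1) + 2 ℓ` is attained on `ℓ + 1 + (s − t)` vertices by a triangle-free graph with `s` edges and a
vertex of degree `s − t`. -/
theorem middle_band_interval (ℓ s t j : ℕ) (ht : 1 ≤ t) (hl1 : t + 1 ≤ ℓ) (hl2 : ℓ ≤ 2 * t) (hl3 : 3 * t ≤ 2 * ℓ + 2)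
    (hs : 2 * t ≤ s) (hj : 2 * j + 2 * t ≤ t * (t - 1) + 2 * ℓ) :
    ∃ (H : SimpleGraph (Fin (ℓ + 1 + (s - t)))) (_ : DecidableRel H.Adj), H.CliqueFree 3 ∧
      H.edgeFinset.card = s ∧ (∃ w, deg H w + t = s) ∧
      ∑ v, deg H v * deg H v + 2 * (t * (s - t - 1)) + 2 * j = s * (s + 1) := by
  -- `λ = min (ℓ − t + 1) t` left vertices (so `t / 2 ≤ λ ≤ t`), `c = ℓ − λ ≥ t − 1` right non-leaves
  obtain ⟨l, hl⟩ : ∃ l, l = min (ℓ - t + 1) t := ⟨_, rfl⟩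
  obtain ⟨c, hc⟩ : ∃ c, c = ℓ - l := ⟨_, rfl⟩
  have hlt : l ≤ t := by omega
  have hl2 : t ≤ 2 * l := by omega
  have hct : t ≤ c + 1 := by omega
  have hlc : l + c = ℓ := by omega
  set n := ℓ + 1 + (s - t) with hn
  have hn0 : 0 < n := by omega
  obtain ⟨a, ha⟩ : ∃ a, a = l + 1 := ⟨_, rfl⟩
  obtain ⟨b, hb⟩ : ∃ b, b = a + (s - t) := ⟨_, rfl⟩
  have hbn : b + c = n := by omega
  -- the balanced left count (`l ≤ t < 2 l`: `2 (t − l)`; `t = 2 l`: `2 l` again)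
  have hcoll0 : coll t (lfRR l 0) = 2 * (t - l) := by
    rcases Nat.lt_or_ge t (2 * l) with h2 | h2
    · exact coll_lfRR_zero_half l t (by omega) hlt h2
    · have ht2 : t = 2 * l := by omega
      rw [coll_lfRR_zero l t (by omega), ht2, Nat.mul_div_cancel _ (by omega), Nat.mul_mod_left]
      ring_nf
      omega
  -- the staircase: `E u = t (t − 1) − coll t (lfRR l u)`
  have hle : ∀ u, coll t (lfRR l u) ≤ t * (t - 1) := fun u => coll_le t _
  have hcover := cover_stair_gen t c hct (fun u => t * (t - 1) - coll t (lfRR l u))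
    (by show t * (t - 1) - coll t (lfRR l t) = 0; rw [coll_lfRR_top, Nat.sub_self])
    (fun u => by
      obtain ⟨x, hx⟩ := coll_even t (lfRR l u)
      obtain ⟨d, hd⟩ := Nat.even_mul_pred_self t
      have := hle u
      exact ⟨d - x, by omega⟩)
    (fun u _ => by
      have h1 := coll_le_coll_add_of_eq_off t (lfRR l (u + 1)) (lfRR l u) u (fun i _ hi => lfRR_eq_off l u i hi)
      have := hle u
      have := hle (u + 1)
      show t * (t - 1) - coll t (lfRR l u) ≤ t * (t - 1) - coll t (lfRR l (u + 1)) + 2 * t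
      omega)
    t le_rfl j ⟨0, by omega, by omega, by
      show 2 * j ≤ t * (t - 1) - coll t (lfRR l 0) + 2 * c
      rw [hcoll0]
      have := hle 0
      rw [hcoll0] at this
      have e1 : 2 * ℓ = 2 * l + 2 * c := by omega
      omega⟩
  obtain ⟨u, -, hu, e, he, hje⟩ := hcover
  -- the pair witness with these ends
  have hg : GoodEnds n a t (lfRR l u) (rfSplit a b e) := by
    refine ⟨fun i hi => ?_, fun i hi => ?_, fun i i' hi hi' h1 h2 => ?_⟩
    · have := lfRR_bounds l u i (by omega)
      omega
    · unfold rfSplit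
      split_ifs <;> omega
    · unfold rfSplit at h2
      split_ifs at h2 <;> omega
  have ha1 : 1 ≤ a := by omega
  have han : a + (s - t) ≤ n := by omega
  have hval := genWitness_missing_value n a s t hn0 (lfRR l u) (rfSplit a b e) hg ha1 ht (by omega) han
  have hatt : ((range t).filter (fun i => rfSplit a b e i < a + (s - t))).card = t - e := by
    have : (range t).filter (fun i => rfSplit a b e i < a + (s - t)) = Ico e t := by
      ext i
      simp only [mem_filter, mem_range, mem_Ico]
      unfold rfSplit
      split_ifs <;> omega
    rw [this, Nat.card_Ico]
  have hrf : coll t (rfSplit a b e) = 0 := by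
    unfold coll
    rw [card_eq_zero, filter_eq_empty_iff]
    intro p hp
    rw [mem_offDiag, mem_range, mem_range] at hp
    unfold rfSplit
    split_ifs <;> omega
  rw [hatt, hrf, Nat.add_zero] at hval
  refine ⟨_, inferInstance, cliqueFree_of_bipSub _ _ (bipSub_missingGraph _ _),
    card_edges_missingGraph_genWitness n a s t hn0 (lfRR l u) (rfSplit a b e) hg ha1 (by omega) han,
    ⟨fin' n hn0 0, by rw [deg_missingGraph_genWitness_zero n a s t hn0 (lfRR l u) (rfSplit a b e) hg ha1 han]; omega⟩,
    ?_⟩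
  have hle' := hle u
  have hte : t - e ≤ t := Nat.sub_le t e
  have hval' : ∑ v, deg (missingGraph (genWitness n a s t hn0 (lfRR l u) (rfSplit a b e)) (leftPart n a)) v *
      deg (missingGraph (genWitness n a s t hn0 (lfRR l u) (rfSplit a b e)) (leftPart n a)) v +
      2 * (t * (s - t - 1)) + (2 * (t - (t - e)) + (t * (t - 1) - coll t (lfRR l u))) = s * (s + 1) := hval
  have : 2 * (t - (t - e)) = 2 * e := by omega
  rw [this] at hval'
  omega

end C047

end TriangleCap

end PercRepro
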